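import Mathlib
import Summits.KontsevichZagierPeriods.Zeta5Search.Families.CubicalChartCT
import Summits.KontsevichZagierPeriods.Zeta5Search.Families.DualConstantTerm
import Summits.KontsevichZagierPeriods.Zeta5Search.Families.DualExactFullCone
import Summits.KontsevichZagierPeriods.Zeta5Search.Brown8.LeadRecPi8Calibration
import Summits.KontsevichZagierPeriods.Zeta5Search.SymRayWedgeDictionary
import HarnessLib

/-!
# ζ(5) search — the census leading coefficient `lead_pi8v` IS the dual constant term; `LeadRec_pi8v` holds

HONEST FRAMING: systematic search; no irrationality claim unless certified.  Cell `pub-zeta5`, certifier 2 (cert-2 g10,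
2026-08-22).  Identities between integers (binomial sums / polynomial coefficients); nothing about `ζ(5)`; no number of
record moves.

WHAT.
* `chart_dualSpanProd` — in the cubical chart of `Families/CubicalChartCT` the six finite `₈π₈`-chords of P2 g6's dual
  Laurent polynomial (`Families/DualConstantTerm.dualSpanProd`) become `x`-monomials times the four binomials
  `1 − x₁x₂`, `1 − x₁⋯x₅`, `1 − x₂⋯x₅`, `1 − x₂x₃x₄`; the six gaps `g_w`, `w ≥ 1`, carry `(1 − x_w)`.
* `cubicalSum A B` — the resulting explicit 4-fold binomial sum (free indices = the four binomials, the five series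
  `(1 − x_w)^{−(B_w+1)}` having their indices forced), and **`dualConstantTerm_eq_cubicalSum`**: for every `a ∈ ℤ⁸` with
  `bzNum a, bzDen a ≥ 0`, `dualConstantTerm a = cubicalSum a` (constant-term invariance, `CubicalChart.coeff_chart`).
* **`lead_pi8v_eq_dualConstantTerm`**: fam-brown8's census 4-fold sum `Brown8.lead_pi8v n` (`Brown8/LeadingCoefficientsA`, the
  torus-chart leading coefficient of the basic cellular family `₈π₈^∨` in the frame `η = (1,4,2,8,6,3,5,7)`, i.e. the cubical
  chart of the DUAL cell) is LITERALLY `cubicalSum` on the diagonal, hence `= dualConstantTerm (n,…,n)`.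
* **`lead_pi8v_eq_Q`**: with cert-2 g8's D-exact (`DualR.dexact_cone`, `Families/DualExactFullCone`) and `QOf_diag`:
  `lead_pi8v n = Q_n` (Brown–Zudilin's (7)) for ALL `n` — the identification cert-2 g6 isolated as the whole content of the
  node (`Brown8/LeadRecPi8Calibration.leadRec_pi8v_iff`).
* **`leadRec_pi8v_holds : Brown8.LeadRec_pi8v`** — the `@[conjecture]`-tagged node of `Brown8/LeadingCoefficientsA.lean`
  (fam-brown8 census: GUESSED-EXACT order-3 recurrence of `lead_pi8v`, verified there on 117 terms) is a THEOREM: the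
  census operator is Brown–Zudilin's recursion (cert-2 g6 `opPi8v_eq_bz`) and `lead_pi8v = Q` solves it (P1's
  `SymmetricRecursion.Q_solvesRec_holds`).
Exact cross-checks outside the kernel: `HOME/cert-2/g10/code/c1_leadpi8v.py`, `c2_general.py` (cubicalSum = dual constant
term on 40 random cone points; `lead_pi8v n = Q_n = dualConstantTerm(n·1)`, `n ≤ 4`).  Standard axioms only.
-/

noncomputable section

open MvPowerSeries Finset

namespace Summit.KontsevichZagierPeriods.Zeta5Search.Families.Cellular

namespace CubicalChart

open Summit.KontsevichZagierPeriods.Zeta5Search.Brown8 (coeffPow sumTo lead_pi8v LeadRec_pi8v leadRec_pi8v_of_eq_Q)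
open Literature.NumberTheory.Irrationality.BrownZudilin2022 (Q QOf)

/-! ## Integer-indexed coefficients and the three extraction rules -/

/-- The coefficient of `x^c` for an INTEGER exponent vector `c` (`0` if some `c_i < 0`). -/
def coeffZ (c : Fin 5 → ℤ) (φ : T5) : ℤ :=
  if ∀ i, 0 ≤ c i then coeff (Finsupp.equivFunOnFinite.symm fun i => (c i).toNat) φ else 0

/-- At a natural exponent vector `coeffZ` is `coeff`. -/
theorem coeffZ_natCast (d : Fin 5 →₀ ℕ) (φ : T5) : coeffZ (fun i => (d i : ℤ)) φ = coeff d φ := by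
  unfold coeffZ
  rw [if_pos fun i => Int.natCast_nonneg _]
  congr 1; ext i; simp

/-- Additivity over finite sums. -/
theorem coeffZ_sum {ι : Type*} (s : Finset ι) (c : Fin 5 → ℤ) (φ : ι → T5) :
    coeffZ c (∑ k ∈ s, φ k) = ∑ k ∈ s, coeffZ c (φ k) := by
  unfold coeffZ
  split_ifs <;> simp [map_sum]

/-- Scalars. -/
theorem coeffZ_C_mul (c : Fin 5 → ℤ) (a : ℤ) (φ : T5) : coeffZ c (C a * φ) = a * coeffZ c φ := by
  unfold coeffZ
  by_cases h : ∀ i, 0 ≤ c i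
  · rw [if_pos h, if_pos h, MvPowerSeries.coeff_C_mul]
  · rw [if_neg h, if_neg h, mul_zero]

/-- **Rule 1 (monomial shift)**: `[x^c] (x^v · φ) = [x^{c − v}] φ`. -/
theorem coeffZ_monomial_mul (c : Fin 5 → ℤ) (v : Fin 5 →₀ ℕ) (φ : T5) :
    coeffZ c (monomial v 1 * φ) = coeffZ (fun i => c i - v i) φ := by
  unfold coeffZ
  by_cases h' : ∀ i, 0 ≤ c i - (v i : ℤ)
  · have h : ∀ i, 0 ≤ c i := fun i => by have := h' i; omega
    rw [if_pos h, if_pos h', coeff_monomial_mul]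
    have hv : v ≤ Finsupp.equivFunOnFinite.symm fun i => (c i).toNat := by
      intro i; simp only [Finsupp.coe_equivFunOnFinite_symm]; have := h' i; have := h i; omega
    rw [if_pos hv, one_mul]
    have hidx : (Finsupp.equivFunOnFinite.symm fun i => (c i).toNat) - v =
        Finsupp.equivFunOnFinite.symm fun i => (c i - (v i : ℤ)).toNat := by
      ext i
      simp only [Finsupp.coe_tsub, Pi.sub_apply, Finsupp.coe_equivFunOnFinite_symm]
      have := h i; have := h' i; omega
    rw [hidx]
  · rw [if_neg h']
    by_cases h : ∀ i, 0 ≤ c i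
    · rw [if_pos h, coeff_monomial_mul, if_neg]
      intro hv
      apply h'
      intro i
      have := hv i
      simp only [Finsupp.coe_equivFunOnFinite_symm] at this
      have := h i; omega
    · rw [if_neg h]

/-- **Rule 2 (binomial factor)**: `[x^c] ((1 − x^v)^A · φ) = Σ_{k=0}^{A} [y^k](1−y)^A · [x^{c − k v}] φ`. -/
theorem coeffZ_oneSubPow_mul (c : Fin 5 → ℤ) (v : Fin 5 →₀ ℕ) (A : ℕ) (φ : T5) :
    coeffZ c ((1 - monomial v 1) ^ A * φ) =
      ∑ k ∈ range (A + 1), coeffPow A k * coeffZ (fun i => c i - k * v i) φ := by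
  have hbin : ((1 : T5) - monomial v 1) ^ A =
      ∑ k ∈ range (A + 1), C ((-1) ^ k * (Nat.choose A k : ℤ)) * monomial (k • v) 1 := by
    rw [sub_eq_neg_add, add_pow]
    refine Finset.sum_congr rfl fun k _ => ?_
    rw [one_pow, mul_one, neg_pow, monomial_pow, one_pow, map_mul (C : ℤ →+* T5), map_pow (C : ℤ →+* T5),
      map_neg (C : ℤ →+* T5), map_one (C : ℤ →+* T5), map_natCast (C : ℤ →+* T5)]
    ring
  rw [hbin, Finset.sum_mul, coeffZ_sum]
  refine Finset.sum_congr rfl fun k _ => ?_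
  rw [mul_assoc, coeffZ_C_mul, coeffZ_monomial_mul, coeffPow_nat_nat]
  rfl

/-- **Rule 3 (the series)**: `[x^c] U(e) = ∏_i [y^{c_i}](1−y)^{e_i}` (zero off the orthant on both sides). -/
theorem coeffZ_U (c : Fin 5 → ℤ) (e : Fin 5 → ℤ) : coeffZ c (U e) = ∏ i, coeffPow (e i) (c i) := by
  unfold coeffZ
  by_cases h : ∀ i, 0 ≤ c i
  · rw [if_pos h, coeff_U]
    refine Finset.prod_congr rfl fun i _ => ?_
    congr 1; simp only [Finsupp.coe_equivFunOnFinite_symm]; have := h i; omega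
  · rw [if_neg h]
    obtain ⟨i, hi⟩ : ∃ i, c i < 0 := by
      by_contra h'; push Not at h'; exact h h'
    exact (Finset.prod_eq_zero (Finset.mem_univ i) (coeffPow_of_idx_neg _ _ hi)).symm

/-! ## The chart images of the six finite `₈π₈`-chords -/

/-- A monomial with exponent vector given as a function is the product of the powers of the variables. -/
theorem monomial_symm_eq (f : Fin 5 → ℕ) :
    (monomial (Finsupp.equivFunOnFinite.symm f) (1 : ℤ) : T5) = ∏ k, x k ^ f k := by
  rw [MvPowerSeries.monomial_one_eq, Finsupp.prod_fintype _ _ (fun i => by simp)]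
  simp

/-- The gaps in the chart, as explicit products. -/
theorem gChart_eq : gChart 0 = x 0 * x 1 * x 2 * x 3 * x 4 ∧ gChart 1 = x 1 * x 2 * x 3 * x 4 * (1 - x 0) ∧
    gChart 2 = x 2 * x 3 * x 4 * (1 - x 1) ∧ gChart 3 = x 3 * x 4 * (1 - x 2) ∧ gChart 4 = x 4 * (1 - x 3) ∧
    gChart 5 = 1 - x 4 := by
  obtain ⟨u1, u2, u3, u4, u5⟩ := unitFac_num
  simp only [gChart, tail, monomial_symm_eq, Fin.prod_univ_five, unitFac_zero, u1, u2, u3, u4, u5]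
  simp

/-- Exponent vector of `x₁x₂` (variables `0,1`). -/
def v01 : Fin 5 →₀ ℕ := Finsupp.equivFunOnFinite.symm fun k => if k.val ≤ 1 then 1 else 0
/-- Exponent vector of `x₂x₃x₄` (variables `1,2,3`). -/
def v123 : Fin 5 →₀ ℕ := Finsupp.equivFunOnFinite.symm fun k => if 1 ≤ k.val ∧ k.val ≤ 3 then 1 else 0

/-- The four binomial monomials as products. -/
theorem binomial_monomials : (monomial v01 (1 : ℤ) : T5) = x 0 * x 1 ∧ (monomial (tail 0) (1 : ℤ) : T5) =
    x 0 * x 1 * x 2 * x 3 * x 4 ∧ (monomial (tail 1) (1 : ℤ) : T5) = x 1 * x 2 * x 3 * x 4 ∧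
    (monomial v123 (1 : ℤ) : T5) = x 1 * x 2 * x 3 := by
  simp only [v01, v123, tail, monomial_symm_eq, Fin.prod_univ_five]
  simp

/-- The chart images of the six finite `₈π₈`-chords `{1,2}, {1..5}, {2..5}, {2,3,4}, {0..3}, {0,1,2}`:
`x₃x₄x₅(1 − x₁x₂)`, `1 − x₁⋯x₅`, `1 − x₂⋯x₅`, `x₅(1 − x₂x₃x₄)`, `x₄x₅`, `x₃x₄x₅` (0-based variables in Lean). -/
theorem chart_spans :
    chart (MvPolynomial.X 1 + MvPolynomial.X 2) = x 2 * x 3 * x 4 * (1 - x 0 * x 1) ∧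
    chart (MvPolynomial.X 1 + MvPolynomial.X 2 + MvPolynomial.X 3 + MvPolynomial.X 4 + MvPolynomial.X 5) =
      1 - x 0 * x 1 * x 2 * x 3 * x 4 ∧
    chart (MvPolynomial.X 2 + MvPolynomial.X 3 + MvPolynomial.X 4 + MvPolynomial.X 5) = 1 - x 1 * x 2 * x 3 * x 4 ∧
    chart (MvPolynomial.X 2 + MvPolynomial.X 3 + MvPolynomial.X 4) = x 4 * (1 - x 1 * x 2 * x 3) ∧
    chart (MvPolynomial.X 0 + MvPolynomial.X 1 + MvPolynomial.X 2 + MvPolynomial.X 3) = x 3 * x 4 ∧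
    chart (MvPolynomial.X 0 + MvPolynomial.X 1 + MvPolynomial.X 2) = x 2 * x 3 * x 4 := by
  obtain ⟨g0, g1, g2, g3, g4, g5⟩ := gChart_eq
  simp only [map_add, chart_X, g0, g1, g2, g3, g4, g5]
  refine ⟨?_, ?_, ?_, ?_, ?_, ?_⟩ <;> ring

/-- The prefactor monomial `x^{c(A)}`, `c(A) = (A₀+A₇)·tail₂ + A₆·tail₃ + A₃·tail₄`, as a product. -/
theorem monomial_cA (A : Fin 8 → ℕ) :
    (monomial ((A 0 + A 7) • tail 2 + A 6 • tail 3 + A 3 • tail 4) (1 : ℤ) : T5) =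
      (x 2 * x 3 * x 4) ^ (A 0 + A 7) * (x 3 * x 4) ^ A 6 * x 4 ^ A 3 := by
  rw [MvPowerSeries.monomial_one_eq, Finsupp.prod_fintype _ _ (fun i => by simp)]
  simp only [Fin.prod_univ_five, Finsupp.coe_add, Finsupp.coe_smul, Pi.add_apply, Pi.smul_apply, tail_apply,
    smul_eq_mul]
  simp only [Fin.isValue, Fin.val_zero, Fin.val_one, Fin.val_two,
    show (3 : Fin 6).val = 3 from rfl, show (4 : Fin 6).val = 4 from rfl, show (3 : Fin 5).val = 3 from rfl,
    show (4 : Fin 5).val = 4 from rfl]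
  norm_num
  ring

/-- **The chart image of the dual numerator**:
`chart(dualSpanProd A) = x^{c(A)} · (1−x₁x₂)^{A₀} (1−x₁⋯x₅)^{A₁} (1−x₂⋯x₅)^{A₂} (1−x₂x₃x₄)^{A₃}`. -/
theorem chart_dualSpanProd (A : Fin 8 → ℕ) :
    chart (dualSpanProd A) = monomial ((A 0 + A 7) • tail 2 + A 6 • tail 3 + A 3 • tail 4) 1 *
      ((1 - monomial v01 1) ^ A 0 * ((1 - monomial (tail 0) 1) ^ A 1 * ((1 - monomial (tail 1) 1) ^ A 2 *
        (1 - monomial v123 1) ^ A 3))) := by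
  obtain ⟨s12, s15, s25, s24, s03, s02⟩ := chart_spans
  obtain ⟨m01, m0, m1, m123⟩ := binomial_monomials
  unfold dualSpanProd
  rw [map_mul, map_mul, map_mul, map_mul, map_mul, map_pow, map_pow, map_pow, map_pow, map_pow, map_pow,
    s12, s15, s25, s24, s03, s02, monomial_cA, m01, m0, m1, m123]
  simp only [mul_pow]
  ring

/-- `dualSpanProd A` is homogeneous of degree `A₀ + A₁ + A₂ + A₃ + A₆ + A₇`. -/
theorem dualSpanProd_isHomogeneous (A : Fin 8 → ℕ) :
    (dualSpanProd A).IsHomogeneous (A 0 + A 1 + A 2 + A 3 + A 6 + A 7) := by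
  have h1 : ∀ i : Fin 6, (MvPolynomial.X i : MvPolynomial (Fin 6) ℤ).IsHomogeneous 1 :=
    fun i => MvPolynomial.isHomogeneous_X ℤ i
  unfold dualSpanProd
  have e : A 0 + A 1 + A 2 + A 3 + A 6 + A 7 =
      1 * A 0 + 1 * A 1 + 1 * A 2 + 1 * A 3 + 1 * A 6 + 1 * A 7 := by ring
  rw [e]
  refine (((((MvPolynomial.IsHomogeneous.pow ?_ _).mul (MvPolynomial.IsHomogeneous.pow ?_ _)).mul
    (MvPolynomial.IsHomogeneous.pow ?_ _)).mul (MvPolynomial.IsHomogeneous.pow ?_ _)).mul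
    (MvPolynomial.IsHomogeneous.pow ?_ _)).mul (MvPolynomial.IsHomogeneous.pow ?_ _)
  · exact (h1 1).add (h1 2)
  · exact ((((h1 1).add (h1 2)).add (h1 3)).add (h1 4)).add (h1 5)
  · exact (((h1 2).add (h1 3)).add (h1 4)).add (h1 5)
  · exact ((h1 2).add (h1 3)).add (h1 4)
  · exact (((h1 0).add (h1 1)).add (h1 2)).add (h1 3)
  · exact ((h1 0).add (h1 1)).add (h1 2)

/-! ## The explicit 4-fold sum and the dual constant term -/

/-- **The cubical-chart sum** of an exponent vector `a ∈ ℤ⁸` (numerators `A = bzNum a`, gaps `B = bzDen a`):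
`Σ_{j₁≤A₀, j₂≤A₁, j₃≤A₂, j₄≤A₃} [1−y]^{A₀}_{j₁} [1−y]^{A₁}_{j₂} [1−y]^{A₂}_{j₃} [1−y]^{A₃}_{j₄} ·
 ∏_{w=1}^{5} [1−y]^{−B_w−1}_{d_{w−1}}` with the forced indices
`d₀ = B₀ − j₁ − j₂`, `d₁ = B₀+B₁ − j₁−j₂−j₃−j₄`, `d₂ = B₀+B₁+B₂ − A₀−A₇ − j₂−j₃−j₄`,
`d₃ = B₀+⋯+B₃ − A₀−A₆−A₇ − j₂−j₃−j₄`, `d₄ = B₀+⋯+B₄ − A₀−A₃−A₆−A₇ − j₂−j₃`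
(`[1−y]^E_k = coeffPow E k = [y^k](1−y)^E`). -/
def cubicalSum (a : Fin 8 → ℤ) : ℤ :=
  let A := bzNum a
  let B := bzDen a
  ∑ j₁ ∈ range ((A 0).toNat + 1), ∑ j₂ ∈ range ((A 1).toNat + 1), ∑ j₃ ∈ range ((A 2).toNat + 1),
    ∑ j₄ ∈ range ((A 3).toNat + 1),
      coeffPow (A 0) j₁ * coeffPow (A 1) j₂ * coeffPow (A 2) j₃ * coeffPow (A 3) j₄ *
        coeffPow (-B 1 - 1) (B 0 - j₁ - j₂) *
        coeffPow (-B 2 - 1) (B 0 + B 1 - j₁ - j₂ - j₃ - j₄) *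
        coeffPow (-B 3 - 1) (B 0 + B 1 + B 2 - A 0 - A 7 - j₂ - j₃ - j₄) *
        coeffPow (-B 4 - 1) (B 0 + B 1 + B 2 + B 3 - A 0 - A 6 - A 7 - j₂ - j₃ - j₄) *
        coeffPow (-B 5 - 1) (B 0 + B 1 + B 2 + B 3 + B 4 - A 0 - A 3 - A 6 - A 7 - j₂ - j₃)

/-- **Constant-term invariance, applied**: on the cone `bzNum a, bzDen a ≥ 0` the dual constant term is the cubical-chart
4-fold sum. -/
theorem dualConstantTerm_eq_cubicalSum (a : Fin 8 → ℤ) (hA : ∀ i, 0 ≤ bzNum a i) (hB : ∀ i, 0 ≤ bzDen a i) :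
    dualConstantTerm a = cubicalSum a := by
  -- the data as natural numbers
  set A : Fin 8 → ℕ := fun i => (bzNum a i).toNat with hAdef
  set B : Fin 6 → ℕ := fun w => (bzDen a (Fin.castLE (by norm_num) w)).toNat with hBdef
  have hAi : ∀ i, (A i : ℤ) = bzNum a i := fun i => Int.toNat_of_nonneg (hA i)
  have hB0 : (B 0 : ℤ) = bzDen a 0 := Int.toNat_of_nonneg (hB 0)
  have hB1 : (B 1 : ℤ) = bzDen a 1 := Int.toNat_of_nonneg (hB 1)
  have hB2 : (B 2 : ℤ) = bzDen a 2 := Int.toNat_of_nonneg (hB 2)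
  have hB3 : (B 3 : ℤ) = bzDen a 3 := Int.toNat_of_nonneg (hB 3)
  have hB4 : (B 4 : ℤ) = bzDen a 4 := Int.toNat_of_nonneg (hB 4)
  have hB5 : (B 5 : ℤ) = bzDen a 5 := Int.toNat_of_nonneg (hB 5)
  -- homogeneity: Σ (finite numerators) = Σ (gaps)
  have hdeg : A 0 + A 1 + A 2 + A 3 + A 6 + A 7 = ∑ w, B w := by
    have h0 := hAi 0; have h1 := hAi 1; have h2 := hAi 2; have h3 := hAi 3; have h6 := hAi 6; have h7 := hAi 7
    simp only [bzNum, Matrix.cons_val] at h0 h1 h2 h3 h6 h7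
    simp only [bzDen, Matrix.cons_val, Literature.NumberTheory.Irrationality.BrownZudilin2022.b24,
      Literature.NumberTheory.Irrationality.BrownZudilin2022.b14,
      Literature.NumberTheory.Irrationality.BrownZudilin2022.b57,
      Literature.NumberTheory.Irrationality.BrownZudilin2022.b35] at hB0 hB1 hB2 hB3 hB4 hB5
    rw [Fin.sum_univ_six]
    zify
    rw [hB0, hB1, hB2, hB3, hB4, hB5]
    omega
  -- constant-term invariance
  have hct := coeff_chart (dualSpanProd A) B (hdeg ▸ dualSpanProd_isHomogeneous A)
  have hlhs : dualConstantTerm a = MvPolynomial.coeff (Finsupp.equivFunOnFinite.symm B) (dualSpanProd A) := rfl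
  rw [hlhs, ← hct, ← coeffZ_natCast, chart_dualSpanProd, mul_assoc, coeffZ_monomial_mul]
  simp only [mul_assoc, coeffZ_oneSubPow_mul, coeffZ_U, Finset.mul_sum]
  -- identify with `cubicalSum`
  unfold cubicalSum
  simp only []
  refine Finset.sum_congr (by rw [hAdef]) fun j₁ _ => Finset.sum_congr (by rw [hAdef]) fun j₂ _ =>
    Finset.sum_congr (by rw [hAdef]) fun j₃ _ => Finset.sum_congr (by rw [hAdef]) fun j₄ _ => ?_
  rw [Fin.prod_univ_five]
  simp only [Mexp_apply, Fin.sum_univ_six, Finsupp.coe_equivFunOnFinite_symm, Finsupp.coe_add, Finsupp.coe_smul,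
    Pi.add_apply, Pi.smul_apply, smul_eq_mul, tail_apply, v01, v123, Fin.isValue]
  simp only [Fin.val_zero, Fin.val_one, Fin.val_two, show (3 : Fin 6).val = 3 from rfl,
    show (4 : Fin 6).val = 4 from rfl, show (5 : Fin 6).val = 5 from rfl, show (3 : Fin 5).val = 3 from rfl,
    show (4 : Fin 5).val = 4 from rfl, Fin.succ_zero_eq_one, Fin.succ_one_eq_two,
    show (2 : Fin 5).succ = 3 from rfl, show (3 : Fin 5).succ = 4 from rfl, show (4 : Fin 5).succ = 5 from rfl]
  norm_num
  rw [hAi 0, hAi 1, hAi 2, hAi 3, hAi 6, hAi 7, hB0, hB1, hB2, hB3, hB4, hB5]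
  ring_nf

/-! ## The diagonal: `lead_pi8v` -/

/-- `sumTo m g = Σ_{k < m+1} g k`. -/
theorem sumTo_eq_sum (m : ℕ) (g : ℕ → ℤ) : sumTo m g = ∑ k ∈ range (m + 1), g k := by
  unfold sumTo
  induction m with
  | zero => simp [List.range_succ]
  | succ m ih => rw [List.range_succ, List.map_append, List.sum_append, ih, Finset.sum_range_succ g (m + 1)]; simp

/-- Reordering a 4-fold sum over one index set: `(k₁,k₂,k₃,k₄) ↦ (j₃,j₂,j₄,j₁)`. -/
theorem sum4_reindex (s : Finset ℕ) (f : ℕ → ℕ → ℕ → ℕ → ℤ) :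
    ∑ k₁ ∈ s, ∑ k₂ ∈ s, ∑ k₃ ∈ s, ∑ k₄ ∈ s, f k₁ k₂ k₃ k₄ =
      ∑ j₁ ∈ s, ∑ j₂ ∈ s, ∑ j₃ ∈ s, ∑ j₄ ∈ s, f j₃ j₂ j₄ j₁ := by
  calc ∑ k₁ ∈ s, ∑ k₂ ∈ s, ∑ k₃ ∈ s, ∑ k₄ ∈ s, f k₁ k₂ k₃ k₄
      = ∑ k₁ ∈ s, ∑ k₂ ∈ s, ∑ k₄ ∈ s, ∑ k₃ ∈ s, f k₁ k₂ k₃ k₄ :=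
        Finset.sum_congr rfl fun _ _ => Finset.sum_congr rfl fun _ _ => Finset.sum_comm
    _ = ∑ k₁ ∈ s, ∑ k₄ ∈ s, ∑ k₂ ∈ s, ∑ k₃ ∈ s, f k₁ k₂ k₃ k₄ :=
        Finset.sum_congr rfl fun _ _ => Finset.sum_comm
    _ = ∑ k₄ ∈ s, ∑ k₁ ∈ s, ∑ k₂ ∈ s, ∑ k₃ ∈ s, f k₁ k₂ k₃ k₄ := Finset.sum_comm
    _ = ∑ k₄ ∈ s, ∑ k₂ ∈ s, ∑ k₁ ∈ s, ∑ k₃ ∈ s, f k₁ k₂ k₃ k₄ :=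
        Finset.sum_congr rfl fun _ _ => Finset.sum_comm

/-- The Brown–Zudilin data of the diagonal `a = n·1⁸`: every numerator and every gap exponent is `n`. -/
theorem bz_diag (n : ℕ) : (∀ i, bzNum (fun _ : Fin 8 => (n : ℤ)) i = n) ∧ ∀ i, bzDen (fun _ : Fin 8 => (n : ℤ)) i = n := by
  refine ⟨fun i => ?_, fun i => ?_⟩
  · fin_cases i <;> simp [bzNum]
  · fin_cases i <;>
      simp [bzDen, Literature.NumberTheory.Irrationality.BrownZudilin2022.b24,
        Literature.NumberTheory.Irrationality.BrownZudilin2022.b14,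
        Literature.NumberTheory.Irrationality.BrownZudilin2022.b57,
        Literature.NumberTheory.Irrationality.BrownZudilin2022.b35,
        Literature.NumberTheory.Irrationality.BrownZudilin2022.b36]

/-- **The census sum IS the cubical-chart sum on the diagonal** (`k₁,k₂,k₃,k₄` of `Brown8/LeadingCoefficientsA` =
`j₃,j₂,j₄,j₁` here; the five `coeffPow (−n−1) ·` factors are the five gap series, the four `coeffPow n ·` the four
binomials). -/
theorem lead_pi8v_eq_cubicalSum (n : ℕ) : lead_pi8v n = cubicalSum (fun _ => (n : ℤ)) := by
  obtain ⟨hA, hB⟩ := bz_diag n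
  unfold lead_pi8v cubicalSum
  simp only [sumTo_eq_sum, hA, hB, Int.toNat_natCast]
  rw [sum4_reindex]
  refine Finset.sum_congr rfl fun j₁ _ => Finset.sum_congr rfl fun j₂ _ => Finset.sum_congr rfl fun j₃ _ =>
    Finset.sum_congr rfl fun j₄ _ => ?_
  ring_nf

/-- Hence **`lead_pi8v n = dualConstantTerm (n·1⁸)`**: the torus-chart leading coefficient of `₈π₈^∨` is the
gap-coordinate constant term of the dual cell. -/
theorem lead_pi8v_eq_dualConstantTerm (n : ℕ) : lead_pi8v n = dualConstantTerm (fun _ => (n : ℤ)) := by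
  obtain ⟨hA, hB⟩ := bz_diag n
  rw [lead_pi8v_eq_cubicalSum, dualConstantTerm_eq_cubicalSum]
  · intro i; rw [hA i]; exact Int.natCast_nonneg n
  · intro i; rw [hB i]; exact Int.natCast_nonneg n

/-- **`lead_pi8v n = Q_n`** (Brown–Zudilin's totally symmetric leading coefficient (7)) for every `n`, by cert-2 g8's
D-exact on the cone (`DualR.dexact_cone`) and `SymRay.QOf_diag`. -/
theorem lead_pi8v_eq_Q (n : ℕ) : lead_pi8v n = Q n := by
  have h1 := lead_pi8v_eq_dualConstantTerm n
  obtain ⟨hA, hB⟩ := bz_diag n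
  have h2 := DualR.dexact_cone (fun _ : Fin 8 => (n : ℤ)) (fun i => by rw [hA i]; exact Int.natCast_nonneg n)
    (fun i => by rw [hB i]; exact Int.natCast_nonneg n)
  have h3 : QOf (fun _ : Fin 8 => (n : ℤ)) = (Q n : ℤ) := SymRay.QOf_diag n
  rw [h1, ← h2, h3]
  exact abs_of_nonneg (Int.natCast_nonneg _)

/-- **The `@[conjecture]` node `Brown8.LeadRec_pi8v` of `Brown8/LeadingCoefficientsA.lean` is a THEOREM**: fam-brown8's
guessed order-3 recurrence of the census leading coefficient of `₈π₈^∨` holds for all `n` (cert-2 g6's reduction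
`leadRec_pi8v_of_eq_Q` + `lead_pi8v_eq_Q`). -/
theorem leadRec_pi8v_holds : LeadRec_pi8v := leadRec_pi8v_of_eq_Q lead_pi8v_eq_Q

end CubicalChart

end Summit.KontsevichZagierPeriods.Zeta5Search.Families.Cellular
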